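import Literature.Computability.Complexity.BPClosureProofs
import HarnessLib

/-!
# `R·K` is closed under Karp reductions; `RP`, `coRP`, `ZPP` closed downward (proofs; trunk CplxCore)

Sibling proof file of `ProbabilisticClasses.lean` (D-0014) and companion of `BPClosureProofs.lean`
(the same facts for Schöning's two-sided operator `bp`): structural facts about the one-sided-error
operator `rp` (`RP = rp P`, `coRP = co RP`, `ZPP = RP ∩ coRP`), PROVED by the re-pairing-and-coin-
truncation argument of `preimage_mem_bp` / `preimage_mem_pMajority`:

* `preimage_mem_rp` — **the `R·` operator preserves closure under polynomial-time preimages**: if `K`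
  is closed under `FP` preimages then so is `rp K`. For `L ∈ rp K` with witness `L'' ∈ K` and coin
  polynomial `p`, and `f ∈ FP` with `|f x| ≤ s(|x|)`, the language `f⁻¹(L)` has the witness
  `(truncSndFn p ∘ mapFstFn f)⁻¹(L'') = {⟨x, y'⟩ | ⟨f x, y'↾p(|f x|)⟩ ∈ L''} ∈ K` and the coin
  polynomial `p ∘ s`; the accepting fraction is unchanged (cylinder lemma `uniformProb_take_of_le`)
  and no coin string accepts when none of length `p(|f x|)` does (Arora–Barak 2009, §7.6: "if
  `C ∈ BPP` and `B ≤ᵣ C` then `B ∈ BPP`" — the one-sided classes behave the same way under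
  DETERMINISTIC reductions; §7.3);
* `preimage_mem_RP`, `mem_RP_of_karpReducible` — `RP` is closed downward under `≤ₚ`;
* `preimage_mem_coRP`, `mem_coRP_of_karpReducible` — so is `coRP` (`f⁻¹(Lᶜ) = (f⁻¹ L)ᶜ`);
* `preimage_mem_ZPP`, `mem_ZPP_of_karpReducible` — and `ZPP = RP ∩ coRP`.

First consumer: `PITLanguage ∈ coRP` from a Karp reduction of `PITLanguage` to the zero set of a
junk-tolerant circuit-code semantics that is in `coRP` by the randomised modular zero test
(`Complexity/RandomizedModularZeroTest.lean`).

## References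

* S. Arora, B. Barak, *Computational Complexity: A Modern Approach*, CUP 2009, Def. 7.6 (`RP`,
  `coRP`), Def. 7.7 (`ZPP`), §7.6 Def. 7.16 (randomized reductions; closure of `BPP`)
  [AroraBarakCC2009].
* U. Schöning, *Probabilistic complexity classes and lowness*, JCSS 39 (1989) 84–100 (the operator
  calculus) [Schoning1989].
-/

namespace Literature.Computability.Complexity

open _root_.Computability Polynomial
open scoped Notation

/-! ### The `R·` operator preserves closure under polynomial-time preimages -/

/-- **`R·K` is closed under `FP` preimages when `K` is.** For `L ∈ rp K` with witness `L'' ∈ K` and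
coin polynomial `p`, and `f ∈ FP` with `|f x| ≤ s(|x|)`, the language `f⁻¹(L)` has the witness
`(truncSndFn p ∘ mapFstFn f)⁻¹(L'') = {⟨x, y'⟩ | ⟨f x, y'↾p(|f x|)⟩ ∈ L''} ∈ K` and coin polynomial
`p ∘ s`: on `f x ∈ L` the accepting fraction is that of `f x` (the verdict depends only on the prefix
of length `p(|f x|) ≤ p(s(|x|))` of the coins), on `f x ∉ L` no coin string accepts.
(Generalises `ValiantVazirani.preimage_mem_rp`, `ValiantVaziraniReduction.lean`, which assumes a
reduction of exactly polynomial length `|f x| = s(|x|)`.) [cite: AroraBarakCC2009, §7.6 (Def. 7.16)] -/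
theorem preimage_mem_rp {K : Set (Language Bool)}
    (hK : ∀ ⦃L : Language Bool⦄, L ∈ K → ∀ ⦃g : List Bool → List Bool⦄, g ∈ FP → g ⁻¹' L ∈ K)
    {L : Language Bool} (hL : L ∈ rp K) {f : List Bool → List Bool} (hf : f ∈ FP) :
    f ⁻¹' L ∈ rp K := by
  obtain ⟨L'', hL'', p, hp⟩ := hL
  obtain ⟨s, hs⟩ := exists_poly_length_le_of_mem_FP hf
  refine ⟨(truncSndFn p ∘ mapFstFn f) ⁻¹' L'',
    hK hL'' (comp_mem_FP (truncSndFn_mem_FP p) (mapFstFn_mem_FP hf)), p.comp s, fun x => ?_⟩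
  set L₃ : Language Bool := (truncSndFn p ∘ mapFstFn f) ⁻¹' L'' with hL₃
  have hmem : ∀ y : List Bool, boolPair x y ∈ L₃ ↔ boolPair (f x) (y.take (p.eval (f x).length)) ∈ L'' := by
    intro y
    change truncSndFn p (mapFstFn f (boolPair x y)) ∈ L'' ↔ _
    rw [mapFstFn_boolPair, truncSndFn_boolPair]
  have hle : p.eval (f x).length ≤ (p.comp s).eval x.length := by
    rw [eval_comp]; exact TM2Iter.eval_mono p (hs x)
  constructor
  · -- `f x ∈ L`: the accepting fraction is preserved
    intro hx
    have hset : {y : List Bool | boolPair x y ∈ L₃} =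
        {y | y.take (p.eval (f x).length) ∈ {y : List Bool | boolPair (f x) y ∈ L''}} := by
      ext y; exact hmem y
    rw [hset, uniformProb_take_of_le hle]
    exact (hp (f x)).1 hx
  · -- `f x ∉ L`: no coin string accepts
    intro hx y hy hy3
    rw [hmem] at hy3
    exact (hp (f x)).2 hx _ (by rw [List.length_take]; omega) hy3

/-! ### `RP`, `coRP`, `ZPP` are closed downward under Karp reductions -/

/-- **`RP` is closed under polynomial-time preimages** (`RP = R·P`, `preimage_mem_P`).
[cite: AroraBarakCC2009, Def. 7.6 and §7.6] -/
theorem preimage_mem_RP {L : Language Bool} (hL : L ∈ RP) {f : List Bool → List Bool}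
    (hf : f ∈ FP) : f ⁻¹' L ∈ RP :=
  preimage_mem_rp (fun _ hL _ hg => preimage_mem_P hL hg) hL hf

/-- **`RP` is closed downward under Karp reductions**: `L₁ ≤ₚ L₂ ∈ RP ⇒ L₁ ∈ RP`.
[cite: AroraBarakCC2009, Def. 7.6 and §7.6] -/
theorem mem_RP_of_karpReducible {L₁ L₂ : Language Bool} (h : L₁ ≤ₚ L₂) (h₂ : L₂ ∈ RP) :
    L₁ ∈ RP := by
  obtain ⟨f, hf, hfL⟩ := h
  rw [show L₁ = f ⁻¹' L₂ from Set.ext hfL]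
  exact preimage_mem_RP h₂ hf

/-- **`coRP` is closed under polynomial-time preimages** (`f⁻¹(Lᶜ) = (f⁻¹ L)ᶜ`).
[cite: AroraBarakCC2009, Def. 7.6 and §7.6] -/
theorem preimage_mem_coRP {L : Language Bool} (hL : L ∈ coRP) {f : List Bool → List Bool}
    (hf : f ∈ FP) : f ⁻¹' L ∈ coRP := by
  change (f ⁻¹' L)ᶜ ∈ RP
  rw [← Set.preimage_compl]
  exact preimage_mem_RP hL hf

/-- **`coRP` is closed downward under Karp reductions**: `L₁ ≤ₚ L₂ ∈ coRP ⇒ L₁ ∈ coRP`.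
[cite: AroraBarakCC2009, Def. 7.6 and §7.6] -/
theorem mem_coRP_of_karpReducible {L₁ L₂ : Language Bool} (h : L₁ ≤ₚ L₂) (h₂ : L₂ ∈ coRP) :
    L₁ ∈ coRP := by
  obtain ⟨f, hf, hfL⟩ := h
  rw [show L₁ = f ⁻¹' L₂ from Set.ext hfL]
  exact preimage_mem_coRP h₂ hf

/-- **`ZPP = RP ∩ coRP` is closed under polynomial-time preimages.** [cite: AroraBarakCC2009, Def. 7.7 and §7.6] -/
theorem preimage_mem_ZPP {L : Language Bool} (hL : L ∈ ZPP) {f : List Bool → List Bool}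
    (hf : f ∈ FP) : f ⁻¹' L ∈ ZPP :=
  ⟨preimage_mem_RP hL.1 hf, preimage_mem_coRP hL.2 hf⟩

/-- **`ZPP` is closed downward under Karp reductions.** [cite: AroraBarakCC2009, Def. 7.7 and §7.6] -/
theorem mem_ZPP_of_karpReducible {L₁ L₂ : Language Bool} (h : L₁ ≤ₚ L₂) (h₂ : L₂ ∈ ZPP) :
    L₁ ∈ ZPP := by
  obtain ⟨f, hf, hfL⟩ := h
  rw [show L₁ = f ⁻¹' L₂ from Set.ext hfL]
  exact preimage_mem_ZPP h₂ hf

end Literature.Computability.Complexity
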